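import Summits.BirchSwinnertonDyer.BirchSwinnertonDyer.Theorems.TwoAdicConverseOrdLambdaHalfAtTwoPinnedDatumDefs
import Summits.BirchSwinnertonDyer.BirchSwinnertonDyer.Theorems.EisensteinPrimesTwoVariableControlBookkeeping
import Summits.BirchSwinnertonDyer.Rank1Residual.X1.LambdaSqueezeAlgebra
import Literature.NumberTheory.EllipticCurves.Kato2004.MainConjectureSkeletonProofs
import Mathlib.LinearAlgebra.Isomorphisms
import HarnessLib

/-!
# Route `TwoAdicConverse` (rung S3), crux `OrdLambdaHalfAtTwo` (item stmt-BirchSwinnertonDyer-19556), line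
# `kato-determinant-greenberg-two`, skeleton v4: the `F⁻`-SUMMAND of the Kato determinant is READ BY THE FIRST RECIPROCITY LAW
# (kernel theorem about every pinned datum)

Seat `cruxlead-stmt-BirchSwinnertonDyer-19556-g1` (LEAD PROVER, MODE LINE; `--supports` stmt-BirchSwinnertonDyer-19556, helper; HOME
`run/shared/lean/pub/bsd-2adic/`).  HONEST FRAMING (cell bsd-2adic): BSD is not proved by any of this; the crux `OrdLambdaHalfAtTwo` is NOT proved
here; nothing about any particular curve is asserted; no definition, no named fact, no `sorry`.

For a pinned Kato–Greenberg datum `P` (Defs `…PinnedDatumDefs`, p674487) write `Hl = 𝐇¹_loc(T₂W|_{Γ_{ℚ₂}})`, `H_f = localOrdinaryPart J' J`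
(the `F⁺`-part), `S = P.zetaSpan` (the localised zeta span `Λ·loc z_E + Λ·𝐇¹(u_A)(loc z_{E^K})`).  The Defs file proves the `±`-decomposition
`gD = λ(H_f ⧸ (H_f ⊓ S)) + λ(Hl ⧸ (H_f ⊔ S))`.  THIS FILE computes the second (`F⁻`, unit-root) summand from the datum's Coleman fields:

* `lambda_minusSide_eq` — **`λ(Hl ⧸ (H_f ⊔ S)) = λ(Λ ⧸ (u_E·2^{n_E}·L₀, u_A·2^{n_A}·L₀'))`**: `Col⁻ : Hl⧸H_f → Λ` (kernel killed by powers of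
  `2`, finite cokernel) induces `(Hl⧸H_f)⧸S̄ → Λ⧸Col⁻(S̄)` whose kernel is elementwise `2`-power torsion and whose cokernel is finite — both
  `λ`-invisible (`λ = dim_{ℚ₂}(ℚ₂ ⊗_{ℤ₂} ·)`) — and `Col⁻(S̄)` is generated by the two reciprocity values `recW`, `recA`.
* `lambda_minusSide_eq_lambda_quotient_span_pair` — the units and powers of `2` are `λ`-invisible: **`= λ(Λ ⧸ (L₀, L₀'))`**.
* `lambda_minusSide_le_lam` / `lambda_minusSide_le_lam'` — hence `≤ λ(L₀)` and `≤ λ(L₀')` (`λ(Λ⧸(L₀)) = lam L₀`, tree bridge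
  `ParitySqueeze.lam_generator_eq_lambdaInvariant` + `charIdeal_quotient_span_singleton`).
* `gD_eq_lambda_plusSide_add` / `gD_le_lambda_iff_plusSide` — CONSEQUENCE FOR THE LINE: for every pinned datum
  `gD = λ(H_f⧸(H_f ⊓ S)) + λ(Λ⧸(L₀, L₀'))`, so the research stub `PinnedGreenbergDivisibilityAtTwo` (∀ pinned datum, `gD ≤ λ(X_Gr)`) is,
  datum by datum, the statement about the `F⁺`-SUMMAND ALONE: `λ(H_f⧸(H_f ⊓ S)) + λ(Λ⧸(L₀, L₀')) ≤ λ(X_Gr)` — the `F⁺`/unit-root-free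
  coordinate of the localised zeta classes (the Greenberg/BDP side, B1@2 + B3 of the card) is the ENTIRE remaining content; the `F⁻`-side is
  Kato's first reciprocity law, now a theorem-grade field read in the kernel.

Pure module algebra over `Λ = ℤ₂⟦T⟧` (tree: `lambdaInvariant_eq_add_of_surjective`, `lambdaInvariant_quotient_eq_add`,
`lambdaInvariant_eq_zero_of_finite`, `lambdaInvariant_eq_of_linearEquiv`, Mathlib's isomorphism theorems); nothing specific to `p = 2` beyond
the datum's typing.  References: K. Kato, Astérisque 295 (2004) Thm 16.6, Prop 17.11, §17.13 [Kato2004Asterisque]; L. Washington, GTM 83 §13.2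
[Washington1997].
-/

set_option linter.dupNamespace false
set_option autoImplicit false

noncomputable section

open scoped Classical NumberField TensorProduct
open WeierstrassCurve NumberField IsDedekindDomain Field CategoryTheory Function
open Literature.NumberTheory.EllipticCurves Literature.NumberTheory.EllipticCurves.Rank1Residual
open Literature.NumberTheory.EllipticCurves.Kato2004 Literature.NumberTheory.EllipticCurves.Kato2004.EulerSystemValues
open Literature.NumberTheory.GaloisRepresentations
open Summit.BirchSwinnertonDyer.Rank1Residual.X1.MuLambda (lam)
open Summit.BirchSwinnertonDyer.Rank1Residual.X11b (AcSelmer.bdpData AcSelmer.strictDatum)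

namespace Summit.BirchSwinnertonDyer.BirchSwinnertonDyer.Theorems.TwoAdicKatoDeterminant

/-! ## §1 Two `λ`-invisibility lemmas over `Λ = ℤ_p⟦T⟧` -/

section Algebra

variable {p : ℕ} [Fact p.Prime]

/-- A `Λ`-module each of whose elements is killed by some power of `p` has `ℚ_p ⊗_{ℤ_p} (·) = 0`, hence `λ = 0`
(`λ = dim_{ℚ_p}(ℚ_p ⊗_{ℤ_p} ·)`; no finiteness needed). [cite: Washington1997, §13.2] -/
theorem lambdaInvariant_eq_zero_of_forall_exists_C_pow_smul_eq_zero {K : Type*} [AddCommGroup K]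
    [Module (IwasawaAlgebra p) K]
    (hK : ∀ x : K, ∃ k : ℕ, (PowerSeries.C ((p : ℤ_[p]) ^ k) : IwasawaAlgebra p) • x = 0) :
    lambdaInvariant p K = 0 := by
  letI iK : Module ℤ_[p] K := Module.compHom K (algebraMap ℤ_[p] (IwasawaAlgebra p))
  have hunit : IsUnit (algebraMap ℤ_[p] ℚ_[p] (p : ℤ_[p])) := by
    rw [isUnit_iff_ne_zero, map_natCast]
    exact_mod_cast (Fact.out : p.Prime).ne_zero
  haveI : Subsingleton (ℚ_[p] ⊗[ℤ_[p]] K) := by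
    refine ⟨fun x y ↦ ?_⟩
    have hz : ∀ z : ℚ_[p] ⊗[ℤ_[p]] K, z = 0 := by
      intro z
      induction z using TensorProduct.induction_on with
      | zero => rfl
      | tmul a k =>
        obtain ⟨n, hn⟩ := hK k
        refine Module.tmul_eq_zero_of_pow_smul_eq_zero ℚ_[p] hunit (n := n) ?_ a
        change (algebraMap ℤ_[p] (IwasawaAlgebra p) ((p : ℤ_[p]) ^ n)) • k = 0
        rw [← PowerSeries.C_eq_algebraMap]
        exact hn
      | add x y hx hy => rw [hx, hy, add_zero]
    rw [hz x, hz y]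
  change Module.finrank ℚ_[p] (ℚ_[p] ⊗[ℤ_[p]] K) = 0
  exact Module.finrank_zero_of_subsingleton

/-- `Λ ⧸ I` is a torsion `Λ`-module as soon as the ideal `I` contains a non-zero element (`Λ` is a domain). [folklore] -/
theorem isTorsion_quotient_of_ne_zero_mem {I : Ideal (IwasawaAlgebra p)} {a : IwasawaAlgebra p} (ha : a ≠ 0)
    (haI : a ∈ I) : Module.IsTorsion (IwasawaAlgebra p) (IwasawaAlgebra p ⧸ I) := by
  intro x
  refine ⟨⟨a, mem_nonZeroDivisors_of_ne_zero ha⟩, ?_⟩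
  obtain ⟨y, rfl⟩ := Submodule.mkQ_surjective I x
  rw [Submonoid.smul_def, Submodule.mkQ_apply, ← Submodule.Quotient.mk_smul, Submodule.Quotient.mk_eq_zero,
    smul_eq_mul]
  exact I.mul_mem_right _ haI

end Algebra

/-! ## §2 The `F⁻`-summand of a pinned datum -/

namespace PinnedKatoGreenbergDatum

variable {W : WeierstrassCurve ℚ} [W.IsElliptic] [ContinuousSMul ℤ_[2] (W.tateModule 2)]
  {A : WeierstrassCurve ℚ} [A.IsElliptic] [ContinuousSMul ℤ_[2] (A.tateModule 2)]
  {κ : ZpExtension ℚ 2} {γ : absoluteGaloisGroup ℚ}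
  {I_W : IwasawaH1Data W 2 κ γ} {I_A : IwasawaH1Data A 2 κ γ}
  {v : HeightOneSpectrum (𝓞 ℚ)} {γᵥ : absoluteGaloisGroup (v.adicCompletion ℚ)}
  {J : LocalIwasawaH1Data κ v ((tateRep W 2).toLocal v) γᵥ}
  {J' : LocalIwasawaH1Data κ v (tateLocalOrdinaryRep W 2 v) γᵥ}
  {J_A : LocalIwasawaH1Data κ v ((tateRep A 2).toLocal v) γᵥ}
  {uA : ((tateRep A 2).toLocal v).toTopRep ⟶ ((tateRep W 2).toLocal v).toTopRep}
  {hsurj : Function.Surjective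
    (κ.toContinuousMonoidHom.comp (resGalOfEmb (closureEmb (K := ℚ) (v.adicCompletion ℚ))))}
  {hγ : κ.IsTopGenerator γ}
  {hγᵥ : κ.IsTopGenerator (resGalOfEmb (closureEmb (K := ℚ) (v.adicCompletion ℚ)) γᵥ)}
  {K : Type} [Field K] [NumberField K] {κK : ZpExtension K 2} {γK : absoluteGaloisGroup K}
  {w : HeightOneSpectrum (𝓞 K)}
  {DGr : (W.baseChange K).GreenbergStrictSelmerDualData κK γK (AcSelmer.bdpData (MK W K) 2 w)}
  {Dfi : (W.baseChange K).GreenbergStrictSelmerDualData κK γK (fineData W K)}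
  {L₀ L₀' : IwasawaAlgebra 2} {b b' : ℕ}
  (P : PinnedKatoGreenbergDatum I_W I_A J J' J_A uA hsurj hγ hγᵥ DGr Dfi L₀ L₀' b b')

/-- The two reciprocity values of the datum, as generators: `a_E = u_E · 2^{n_E} · L₀`. [cite: Kato2004Asterisque, Thm 16.6 (2)] -/
def recValueW : IwasawaAlgebra 2 := (P.unitW : IwasawaAlgebra 2) * PowerSeries.C ((2 : ℤ_[2]) ^ P.nW) * L₀

/-- The two reciprocity values of the datum, as generators: `a_A = u_A · 2^{n_A} · L₀'`. [cite: Kato2004Asterisque, Thm 16.6 (2)] -/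
def recValueA : IwasawaAlgebra 2 := (P.unitA : IwasawaAlgebra 2) * PowerSeries.C ((2 : ℤ_[2]) ^ P.nA) * L₀'

/-- The ideal of `Λ` generated by the two reciprocity values. [cite: Kato2004Asterisque, Thm 16.6 (2)] -/
def recIdeal : Ideal (IwasawaAlgebra 2) := Ideal.span {P.recValueW} ⊔ Ideal.span {P.recValueA}

/-- The localised zeta span read modulo `H_f`: `S̄ = S.map (Hl → Hl⧸H_f)`. [cite: Kato2004Asterisque, §17.13 (17.13.1)] -/
def zetaSpanBar : Submodule (IwasawaAlgebra 2) (J.H ⧸ localOrdinaryPart J' J) :=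
  P.zetaSpan.map (localOrdinaryPart J' J).mkQ

/-- `Col⁻(S̄)` is the ideal generated by the two reciprocity values (`map_span` + the fields `recW`, `recA`).
[cite: Kato2004Asterisque, Thm 16.6 (2)] -/
theorem map_colMinus_zetaSpanBar : P.zetaSpanBar.map P.colMinus = P.recIdeal := by
  rw [zetaSpanBar, zetaSpan, Submodule.map_sup, Submodule.map_sup, ← Submodule.map_comp, ← Submodule.map_comp,
    ← Submodule.map_comp, ← Submodule.map_comp, Submodule.map_span, Submodule.map_span, Set.image_singleton,
    Set.image_singleton, recIdeal, recValueW, recValueA]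
  have hW : ((P.colMinus ∘ₗ (localOrdinaryPart J' J).mkQ) ∘ₗ I_W.loc J hsurj hγ hγᵥ) P.zW =
      (P.unitW : IwasawaAlgebra 2) * PowerSeries.C ((2 : ℤ_[2]) ^ P.nW) * L₀ := by
    simp only [LinearMap.coe_comp, Function.comp_apply]
    exact P.recW
  have hA : ((P.colMinus ∘ₗ (localOrdinaryPart J' J).mkQ) ∘ₗ (J_A.map uA J ∘ₗ I_A.loc J_A hsurj hγ hγᵥ)) P.zA =
      (P.unitA : IwasawaAlgebra 2) * PowerSeries.C ((2 : ℤ_[2]) ^ P.nA) * L₀' := by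
    simp only [LinearMap.coe_comp, Function.comp_apply]
    exact P.recA
  rw [hW, hA]

/-- The reciprocity value `a_E` is non-zero when `L₀ ≠ 0`. [folklore] -/
theorem recValueW_ne_zero (hL₀ : L₀ ≠ 0) : P.recValueW ≠ 0 := by
  rw [recValueW]
  refine mul_ne_zero (mul_ne_zero P.unitW.ne_zero ?_) hL₀
  exact Summit.BirchSwinnertonDyer.Rank1Residual.X1.MuLambda.C_pow_ne_zero P.nW

/-- `Λ ⧸ (a_E, a_A)` is `Λ`-torsion (`a_E ≠ 0`). [folklore] -/
theorem isTorsion_quotient_recIdeal (hL₀ : L₀ ≠ 0) :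
    Module.IsTorsion (IwasawaAlgebra 2) (IwasawaAlgebra 2 ⧸ P.recIdeal) :=
  isTorsion_quotient_of_ne_zero_mem (P.recValueW_ne_zero hL₀)
    (Submodule.mem_sup_left (Ideal.mem_span_singleton_self _))

/-- The comparison map `φ : (Hl⧸H_f)⧸S̄ → Λ⧸(a_E, a_A)` induced by `Col⁻`. [cite: Kato2004Asterisque, Prop 17.11 (shape)] -/
def colMinusBar : ((J.H ⧸ localOrdinaryPart J' J) ⧸ P.zetaSpanBar) →ₗ[IwasawaAlgebra 2]
    (IwasawaAlgebra 2 ⧸ P.recIdeal) :=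
  P.zetaSpanBar.mapQ P.recIdeal P.colMinus (by rw [← P.map_colMinus_zetaSpanBar]; exact Submodule.le_comap_map _ _)

/-- Every element of `ker φ` is killed by a power of `2` (the kernel of `Col⁻` is). [cite: Kato2004Asterisque, Prop 17.11 (shape)] -/
theorem exists_C_pow_smul_eq_zero_of_mem_ker (x : LinearMap.ker P.colMinusBar) :
    ∃ k : ℕ, (PowerSeries.C ((2 : ℤ_[2]) ^ k) : IwasawaAlgebra 2) • x = 0 := by
  obtain ⟨x, hx⟩ := x
  obtain ⟨q, rfl⟩ := Submodule.mkQ_surjective _ x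
  rw [LinearMap.mem_ker, Submodule.mkQ_apply, colMinusBar, Submodule.mapQ_apply, Submodule.Quotient.mk_eq_zero,
    ← map_colMinus_zetaSpanBar, Submodule.mem_map] at hx
  obtain ⟨s, hs, hsq⟩ := hx
  obtain ⟨k, hk⟩ := P.colMinus_ker (q - s) (by rw [map_sub, hsq, sub_self])
  refine ⟨k, Subtype.ext ?_⟩
  change (PowerSeries.C ((2 : ℤ_[2]) ^ k) : IwasawaAlgebra 2) • (Submodule.mkQ _ q) = 0
  have hqs : (PowerSeries.C ((2 : ℤ_[2]) ^ k) : IwasawaAlgebra 2) • q =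
      (PowerSeries.C ((2 : ℤ_[2]) ^ k) : IwasawaAlgebra 2) • s := by
    rw [smul_sub, sub_eq_zero] at hk
    exact hk
  rw [← map_smul, hqs, map_smul, Submodule.mkQ_apply, (Submodule.Quotient.mk_eq_zero _).mpr hs, smul_zero]

/-- `λ(ker φ) = 0`. [cite: Washington1997, §13.2] -/
theorem lambdaInvariant_ker_colMinusBar : lambdaInvariant 2 (LinearMap.ker P.colMinusBar) = 0 :=
  lambdaInvariant_eq_zero_of_forall_exists_C_pow_smul_eq_zero P.exists_C_pow_smul_eq_zero_of_mem_ker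

/-- The range of `φ` is the image of `range Col⁻` in `Λ⧸(a_E, a_A)`. [folklore] -/
theorem range_colMinusBar :
    LinearMap.range P.colMinusBar = (LinearMap.range P.colMinus).map P.recIdeal.mkQ := by
  have h : P.colMinusBar ∘ₗ P.zetaSpanBar.mkQ = P.recIdeal.mkQ ∘ₗ P.colMinus := Submodule.mapQ_mkQ _ _ _
  rw [← LinearMap.range_comp, ← h, LinearMap.range_comp, Submodule.range_mkQ, Submodule.map_top]

/-- The cokernel of `φ` is finite (a quotient of the finite cokernel of `Col⁻`). [cite: Kato2004Asterisque, Prop 17.11 (shape)] -/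
theorem finite_coker_colMinusBar :
    Finite ((IwasawaAlgebra 2 ⧸ P.recIdeal) ⧸ LinearMap.range P.colMinusBar) := by
  haveI := P.colMinus_coker
  let g : (IwasawaAlgebra 2 ⧸ LinearMap.range P.colMinus) →ₗ[IwasawaAlgebra 2]
      ((IwasawaAlgebra 2 ⧸ P.recIdeal) ⧸ LinearMap.range P.colMinusBar) :=
    (LinearMap.range P.colMinus).mapQ _ P.recIdeal.mkQ
      (by rw [range_colMinusBar]; exact Submodule.le_comap_map _ _)
  refine Finite.of_surjective g fun y ↦ ?_
  obtain ⟨y, rfl⟩ := Submodule.mkQ_surjective _ y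
  obtain ⟨z, rfl⟩ := Submodule.mkQ_surjective _ y
  exact ⟨Submodule.mkQ _ z, by rw [Submodule.mkQ_apply, Submodule.mapQ_apply]; rfl⟩

/-- **The `F⁻`-summand is read by the first reciprocity law**: for every pinned datum with `L₀ ≠ 0`,
`λ(Hl ⧸ (H_f ⊔ S)) = λ(Λ ⧸ (u_E·2^{n_E}·L₀, u_A·2^{n_A}·L₀'))`. [cite: Kato2004Asterisque, Thm 16.6 (2) and Prop 17.11 (shape; the fields recW/recA)]
[cite: Washington1997, §13.2] -/
theorem lambda_minusSide_eq (hL₀ : L₀ ≠ 0) :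
    lambdaInvariant 2 (J.H ⧸ (localOrdinaryPart J' J ⊔ P.zetaSpan)) =
      lambdaInvariant 2 (IwasawaAlgebra 2 ⧸ P.recIdeal) := by
  haveI := P.finiteHl
  -- `(Hl⧸H_f)⧸S̄ ≅ Hl⧸(H_f ⊔ S)`, torsion as a quotient of `Hl⧸S`
  let e := Submodule.quotientQuotientEquivQuotientSup (localOrdinaryPart J' J) P.zetaSpan
  have htorS : Module.IsTorsion (IwasawaAlgebra 2) (J.H ⧸ P.zetaSpan) := P.isTorsion_quot
  have htor1 : Module.IsTorsion (IwasawaAlgebra 2) (J.H ⧸ (localOrdinaryPart J' J ⊔ P.zetaSpan)) :=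
    TwoAdicPoitouTateTwoWays.isTorsion_of_surjective 2
      (P.zetaSpan.mapQ (localOrdinaryPart J' J ⊔ P.zetaSpan) LinearMap.id le_sup_right)
      (fun y ↦ by
        obtain ⟨y, rfl⟩ := Submodule.mkQ_surjective _ y
        exact ⟨Submodule.mkQ _ y, by rw [Submodule.mkQ_apply, Submodule.mapQ_apply]; rfl⟩) htorS
  have htor2 : Module.IsTorsion (IwasawaAlgebra 2) ((J.H ⧸ localOrdinaryPart J' J) ⧸ P.zetaSpanBar) :=
    TwoAdicPoitouTateTwoWays.isTorsion_of_injective 2 e.toLinearMap e.injective htor1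
  rw [← lambdaInvariant_eq_of_linearEquiv e]
  change lambdaInvariant 2 ((J.H ⧸ localOrdinaryPart J' J) ⧸ P.zetaSpanBar) = _
  -- `λ((Hl⧸H_f)⧸S̄) = λ(ker φ) + λ(range φ)`
  have h1 := Summit.BirchSwinnertonDyer.Rank1Residual.X2.DualRestrictionInvariants.lambdaInvariant_eq_add_of_surjective 2
    (π := P.colMinusBar.rangeRestrict) htor2 (LinearMap.surjective_rangeRestrict _)
  rw [LinearMap.ker_rangeRestrict, lambdaInvariant_ker_colMinusBar, zero_add] at h1
  -- `λ(Λ⧸(a_E,a_A)) = λ(range φ) + λ(coker φ)`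
  have h2 := Summit.BirchSwinnertonDyer.Rank1Residual.X2.DualRestrictionInvariants.lambdaInvariant_eq_add_of_surjective 2
    (π := (LinearMap.range P.colMinusBar).mkQ) (P.isTorsion_quotient_recIdeal hL₀) (Submodule.mkQ_surjective _)
  haveI := P.finite_coker_colMinusBar
  rw [lambdaInvariant_eq_of_linearEquiv (LinearEquiv.ofEq _ _ (Submodule.ker_mkQ _)),
    IwasawaTwoVariable.lambdaInvariant_eq_zero_of_finite 2
      (X := (IwasawaAlgebra 2 ⧸ P.recIdeal) ⧸ LinearMap.range P.colMinusBar), add_zero] at h2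
  rw [h1, h2]

/-- The units and powers of `2` are `λ`-invisible: `λ(Λ ⧸ (a_E, a_A)) = λ(Λ ⧸ (L₀, L₀'))`. [cite: Washington1997, §13.2] -/
theorem lambdaInvariant_quotient_recIdeal_eq (hL₀ : L₀ ≠ 0) :
    lambdaInvariant 2 (IwasawaAlgebra 2 ⧸ P.recIdeal) =
      lambdaInvariant 2 (IwasawaAlgebra 2 ⧸ (Ideal.span {L₀} ⊔ Ideal.span {L₀'})) := by
  set Jd : Ideal (IwasawaAlgebra 2) := Ideal.span {L₀} ⊔ Ideal.span {L₀'} with hJd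
  have hIJ : P.recIdeal ≤ Jd := by
    refine sup_le ?_ ?_
    · rw [Ideal.span_singleton_le_iff_mem, recValueW]
      exact Submodule.mem_sup_left (Ideal.mem_span_singleton.mpr (Dvd.intro_left _ rfl))
    · rw [Ideal.span_singleton_le_iff_mem, recValueA]
      exact Submodule.mem_sup_right (Ideal.mem_span_singleton.mpr (Dvd.intro_left _ rfl))
  have h := TwoAdicPoitouTateTwoWays.lambdaInvariant_quotient_eq_add 2 P.recIdeal Jd hIJ
    (P.isTorsion_quotient_recIdeal hL₀)
  -- `Jd ⧸ recIdeal` is killed by `2^{n_E + n_A}`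
  have hkill : ∀ x : ↥(Submodule.map P.recIdeal.mkQ Jd),
      (PowerSeries.C ((2 : ℤ_[2]) ^ (P.nW + P.nA)) : IwasawaAlgebra 2) • x = 0 := by
    rintro ⟨x, hx⟩
    obtain ⟨j, hj, rfl⟩ := Submodule.mem_map.mp hx
    refine Subtype.ext ?_
    change (PowerSeries.C ((2 : ℤ_[2]) ^ (P.nW + P.nA)) : IwasawaAlgebra 2) • P.recIdeal.mkQ j = 0
    rw [← map_smul, Submodule.mkQ_apply, Submodule.Quotient.mk_eq_zero, smul_eq_mul]
    obtain ⟨y, hy, z, hz, rfl⟩ := Submodule.mem_sup.mp hj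
    obtain ⟨r, rfl⟩ := Ideal.mem_span_singleton'.mp hy
    obtain ⟨r', rfl⟩ := Ideal.mem_span_singleton'.mp hz
    rw [mul_add]
    refine Submodule.add_mem _ (Submodule.mem_sup_left ?_) (Submodule.mem_sup_right ?_)
    · refine Ideal.mem_span_singleton'.mpr ⟨r * (↑P.unitW⁻¹ : IwasawaAlgebra 2) * PowerSeries.C ((2 : ℤ_[2]) ^ P.nA), ?_⟩
      rw [recValueW, pow_add, map_mul]
      have hu : (↑P.unitW⁻¹ : IwasawaAlgebra 2) * (P.unitW : IwasawaAlgebra 2) = 1 := Units.inv_mul _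
      linear_combination (r * PowerSeries.C ((2 : ℤ_[2]) ^ P.nA) * PowerSeries.C ((2 : ℤ_[2]) ^ P.nW) * L₀) * hu
    · refine Ideal.mem_span_singleton'.mpr ⟨r' * (↑P.unitA⁻¹ : IwasawaAlgebra 2) * PowerSeries.C ((2 : ℤ_[2]) ^ P.nW), ?_⟩
      rw [recValueA, pow_add, map_mul]
      have hu : (↑P.unitA⁻¹ : IwasawaAlgebra 2) * (P.unitA : IwasawaAlgebra 2) = 1 := Units.inv_mul _
      linear_combination (r' * PowerSeries.C ((2 : ℤ_[2]) ^ P.nW) * PowerSeries.C ((2 : ℤ_[2]) ^ P.nA) * L₀') * hu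
  have hzero : lambdaInvariant 2 ↥(Submodule.map P.recIdeal.mkQ Jd) = 0 :=
    lambdaInvariant_eq_zero_of_forall_exists_C_pow_smul_eq_zero fun x ↦ ⟨P.nW + P.nA, hkill x⟩
  rw [h, hzero, zero_add]

/-- **The `F⁻`-summand in final form**: `λ(Hl ⧸ (H_f ⊔ S)) = λ(Λ ⧸ (L₀, L₀'))` for every pinned datum with `L₀ ≠ 0`.
[cite: Kato2004Asterisque, Thm 16.6 (2), Prop 17.11 (shape)] [cite: Washington1997, §13.2] -/
theorem lambda_minusSide_eq_lambda_quotient_span_pair (hL₀ : L₀ ≠ 0) :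
    lambdaInvariant 2 (J.H ⧸ (localOrdinaryPart J' J ⊔ P.zetaSpan)) =
      lambdaInvariant 2 (IwasawaAlgebra 2 ⧸ (Ideal.span {L₀} ⊔ Ideal.span {L₀'})) := by
  rw [P.lambda_minusSide_eq hL₀, P.lambdaInvariant_quotient_recIdeal_eq hL₀]

/-- `λ(Λ ⧸ (g)) = λ(g)` for `g ≠ 0` (tree bridge: the characteristic ideal of `Λ⧸(g)` is `(g)`). [cite: Washington1997, §13.2] -/
theorem lambdaInvariant_quotient_span_singleton_eq_lam {g : IwasawaAlgebra 2} (hg : g ≠ 0) :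
    lambdaInvariant 2 (IwasawaAlgebra 2 ⧸ Ideal.span {g}) = lam g :=
  (Summit.BirchSwinnertonDyer.Rank1Residual.X1.ParitySqueeze.lam_generator_eq_lambdaInvariant
    (IwasawaAlgebra 2 ⧸ Ideal.span {g}) (isTorsion_quotient_of_ne_zero_mem hg (Ideal.mem_span_singleton_self g)) hg
    (Literature.NumberTheory.EllipticCurves.Module.charIdeal_eq_span_of_lengthAt_eq_quotient hg fun _ _ ↦ rfl)).symm

/-- `λ(Λ ⧸ (L₀, L₀')) ≤ λ(L₀)`. [cite: Washington1997, §13.2] -/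
theorem lambdaInvariant_quotient_span_pair_le_lam (hL₀ : L₀ ≠ 0) :
    lambdaInvariant 2 (IwasawaAlgebra 2 ⧸ (Ideal.span {L₀} ⊔ Ideal.span {L₀'})) ≤ lam L₀ := by
  have h := TwoAdicPoitouTateTwoWays.lambdaInvariant_quotient_eq_add 2 (Ideal.span {L₀})
    (Ideal.span {L₀} ⊔ Ideal.span {L₀'}) le_sup_left
    (isTorsion_quotient_of_ne_zero_mem hL₀ (Ideal.mem_span_singleton_self L₀))
  rw [lambdaInvariant_quotient_span_singleton_eq_lam hL₀] at h
  omega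

/-- `λ(Λ ⧸ (L₀, L₀')) ≤ λ(L₀')`. [cite: Washington1997, §13.2] -/
theorem lambdaInvariant_quotient_span_pair_le_lam' (hL₀' : L₀' ≠ 0) :
    lambdaInvariant 2 (IwasawaAlgebra 2 ⧸ (Ideal.span {L₀} ⊔ Ideal.span {L₀'})) ≤ lam L₀' := by
  have h := TwoAdicPoitouTateTwoWays.lambdaInvariant_quotient_eq_add 2 (Ideal.span {L₀'})
    (Ideal.span {L₀} ⊔ Ideal.span {L₀'}) le_sup_right
    (isTorsion_quotient_of_ne_zero_mem hL₀' (Ideal.mem_span_singleton_self L₀'))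
  rw [lambdaInvariant_quotient_span_singleton_eq_lam hL₀'] at h
  omega

/-- `λ(Hl ⧸ (H_f ⊔ S)) ≤ λ(L₀)` — the `F⁻`-summand is bounded by Kato's own `λ`. [cite: Kato2004Asterisque, Thm 16.6 (2) (shape)] -/
theorem lambda_minusSide_le_lam (hL₀ : L₀ ≠ 0) :
    lambdaInvariant 2 (J.H ⧸ (localOrdinaryPart J' J ⊔ P.zetaSpan)) ≤ lam L₀ := by
  rw [P.lambda_minusSide_eq_lambda_quotient_span_pair hL₀]
  exact lambdaInvariant_quotient_span_pair_le_lam hL₀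

/-- `λ(Hl ⧸ (H_f ⊔ S)) ≤ λ(L₀')`. [cite: Kato2004Asterisque, Thm 16.6 (2) (shape)] -/
theorem lambda_minusSide_le_lam' (hL₀ : L₀ ≠ 0) (hL₀' : L₀' ≠ 0) :
    lambdaInvariant 2 (J.H ⧸ (localOrdinaryPart J' J ⊔ P.zetaSpan)) ≤ lam L₀' := by
  rw [P.lambda_minusSide_eq_lambda_quotient_span_pair hL₀]
  exact lambdaInvariant_quotient_span_pair_le_lam' hL₀'

/-! ## §3 Consequence for the line: the research stub is a statement about the `F⁺`-summand alone -/

/-- **`gD = λ(H_f ⧸ (H_f ⊓ S)) + λ(Λ ⧸ (L₀, L₀'))`** for every pinned datum with `L₀ ≠ 0` (the `±`-decomposition of the Defs with the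
`F⁻`-summand read by the first reciprocity law). [cite: Kato2004Asterisque, Thm 16.6 (2), §17.13 (shape)] -/
theorem gD_eq_lambda_plusSide_add (hL₀ : L₀ ≠ 0) :
    P.gD = lambdaInvariant 2 (↥(localOrdinaryPart J' J) ⧸ (P.zetaSpan).comap (localOrdinaryPart J' J).subtype) +
      lambdaInvariant 2 (IwasawaAlgebra 2 ⧸ (Ideal.span {L₀} ⊔ Ideal.span {L₀'})) := by
  rw [P.gD_eq_lambda_plus_add_lambda_minus, P.lambda_minusSide_eq_lambda_quotient_span_pair hL₀]

/-- **The research stub, datum by datum, is about the `F⁺`-summand**: `gD ≤ λ(X_Gr)` iff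
`λ(H_f ⧸ (H_f ⊓ S)) + λ(Λ ⧸ (L₀, L₀')) ≤ λ(X_Gr)` (so the `Col⁺`-coordinate of the localised zeta classes — the Greenberg/BDP side — carries
the whole remaining content of `PinnedGreenbergDivisibilityAtTwo`). [cite: Kato2004Asterisque, §17.13 (shape)] -/
theorem gD_le_lambda_iff_plusSide (hL₀ : L₀ ≠ 0) :
    P.gD ≤ lambdaInvariant 2 DGr.X ↔
      lambdaInvariant 2 (↥(localOrdinaryPart J' J) ⧸ (P.zetaSpan).comap (localOrdinaryPart J' J).subtype) +
        lambdaInvariant 2 (IwasawaAlgebra 2 ⧸ (Ideal.span {L₀} ⊔ Ideal.span {L₀'})) ≤ lambdaInvariant 2 DGr.X := by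
  rw [P.gD_eq_lambda_plusSide_add hL₀]

end PinnedKatoGreenbergDatum

end Summit.BirchSwinnertonDyer.BirchSwinnertonDyer.Theorems.TwoAdicKatoDeterminant

end
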